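import Mathlib.Algebra.MvPolynomial.Monad
import Mathlib.LinearAlgebra.ExteriorPower.Basis
import Literature.AlgebraicGeometry.Motives.AffineAlgebraicDeRham
import HarnessLib

/-!
# Pull-back of polynomial differential forms along a polynomial map

Topic `Literature/AlgebraicGeometry/Motives` (definition request `defn-AffineMotivatedPresentation`
of route `KontsevichZagierPeriods/MotivatedMoves`, part (a): functoriality of the affine algebraic
de Rham complex of `Motives/AffineAlgebraicDeRham.lean`).

A polynomial map `F : 𝔸ⁿ_k → 𝔸ᵐ_k` is a tuple `F = (F₁, …, F_m)` of polynomials in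
`k[x₁, …, xₙ]`, i.e. the `k`-algebra map `F♯ = bind₁ F (= aeval F) : k[y₁, …, y_m] → k[x₁, …, xₙ]`,
`g ↦ g(F)`. This file defines, concretely and sorry-free, the **pull-back of polynomial forms**
`F^* : Ω^p_{k[y]/k} → Ω^p_{k[x]/k}` (`AffineDeRham.PolyForm.comap F`) in the encoding of
`AffineDeRham.PolyForm` (alternating maps on constant integer vector fields):

  `(F^*ω)(v₁, …, v_p) = Σ_{J : Fin p → Fin m} ω(e_{J 1}, …, e_{J p})(F) · ∏ₐ ∂_{vₐ} F_{J a}`,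

the multilinear expansion of `ω_F(dF(v₁), …, dF(v_p))` with `dF(v) = Σⱼ (∂_v Fⱼ) eⱼ`
(so `F^*(g dy_{j₁} ∧ ⋯ ∧ dy_{j_p}) = g(F) dF_{j₁} ∧ ⋯ ∧ dF_{j_p}`), and proves

* `PolyForm.comap_apply`, `comap_ofPoly` (`F^* g = g ∘ F` on functions), `comap_polySmul`
  (`F^*(g ω) = g(F) F^*ω`);
* `AffineDeRham.dirDeriv_bind₁` — the **chain rule** `∂_v (g(F)) = Σⱼ (∂g/∂yⱼ)(F) · ∂_v Fⱼ`;
* `PolyForm.comap_dWedge` — `F^*(dg ∧ ω) = d(g ∘ F) ∧ F^*ω`;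
* `PolyForm.comap_extDeriv` — **`F^* ∘ d = d ∘ F^*`** (naturality of the exterior derivative),
  via the decomposition `ω = Σ_{J increasing} ω(e_J) dy_J` (`PolyForm.eq_sum_smul_dXs`, from
  Mathlib's basis of the exterior power, `Module.Basis.exteriorPower`) and
  `d(dF_{j₁} ∧ ⋯ ∧ dF_{j_p}) = 0`;
* `PolyForm.comap_mem_vanishingForms` — if `F` maps `V(I) ⊆ 𝔸ⁿ` into `V(I') ⊆ 𝔸ᵐ`
  algebraically (`I'.map F♯ ≤ I`), then `F^*` maps the forms vanishing on `V(I')` to forms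
  vanishing on `V(I)`, hence forms closed/exact on `V(I')` to forms closed/exact on `V(I)`
  (`IsClosedOn.comap`, `IsExactOn.comap`): `F^*` descends to regular forms and to algebraic
  de Rham cohomology `H_dR(V(I')) → H_dR(V(I))`.

All of this is the standard functoriality of Kähler differentials
`Ω^p_{B/k} → Ω^p_{A/k}` along a `k`-algebra map `B → A` [Hartshorne 1977, II.8; Grothendieck 1966,
p. 96 (functoriality of `H_dR`)], written out in coordinates.

## Design notes

* The pull-back is first built as a multilinear map (`PolyForm.comapMultilinear`, a sum over
  `J` of products `∏ₐ ∂_{vₐ} F_{J a}`, Mathlib's `MultilinearMap.mkPiAlgebra` composed with the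
  gradients `AffineDeRham.grad`) and shown to be alternating by the involution `J ↦ J ∘ swap`.
  It is packaged as a `k`-linear map; semilinearity over `F♯` is the lemma `comap_polySmul`.
* We write `bind₁ F` rather than `aeval F` (Mathlib's `simp`-normal form, `aeval_eq_bind₁`).
* `dXs p J = dy_{J 0} ∧ (dy_{J 1} ∧ ⋯)` is defined by the `dWedge` recursion of
  `AffineAlgebraicDeRham.lean` (no general wedge product is needed); its values on increasing
  basis tuples are Kronecker deltas (`dXs_apply_single`).
* Mathlib has no pull-back of Kähler `p`-forms along algebra maps beyond `p = 1`
  (`KaehlerDifferential.map`); searched `KaehlerDifferential.map`, `exteriorPower.map`,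
  `pderiv` + `bind₁` (no chain rule for `pderiv` under `bind₁`/`aeval`).

## References

* R. Hartshorne, *Algebraic Geometry* (1977), II.8 (functoriality of `Ω_{B/A}`). [Hartshorne1977]
* A. Grothendieck, *On the de Rham cohomology of algebraic varieties*, Publ. Math. IHÉS 29 (1966),
  pp. 95–96 (functoriality of algebraic de Rham cohomology). [Grothendieck1966]
-/

noncomputable section

open MvPolynomial

namespace Literature.AlgebraicGeometry.Motives

namespace AffineDeRham

variable {k : Type*} [CommRing k] {n m p : ℕ}

/-! ### The chain rule for directional derivatives -/

/-- Along the coordinate field `eⱼ` the directional derivative is `∂/∂yⱼ` (pointwise form of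
`dirDeriv_single`). [folklore] -/
theorem dirDeriv_single_eq_pderiv (j : Fin m) (g : MvPolynomial (Fin m) k) :
    dirDeriv (Pi.single j 1) g = pderiv j g := by
  rw [dirDeriv_single]

/-- **Chain rule.** For a polynomial map `F = (F₁, …, F_m) : 𝔸ⁿ → 𝔸ᵐ` and `g ∈ k[y₁, …, y_m]`,
`∂_v (g(F)) = Σⱼ (∂g/∂yⱼ)(F) · ∂_v Fⱼ` for every constant vector field `v ∈ ℤⁿ`. [folklore] -/
theorem dirDeriv_bind₁ (F : Fin m → MvPolynomial (Fin n) k) (v : Fin n → ℤ)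
    (g : MvPolynomial (Fin m) k) :
    dirDeriv v (bind₁ F g) = ∑ j, bind₁ F (pderiv j g) * dirDeriv v (F j) := by
  induction g using MvPolynomial.induction_on with
  | C a =>
    simp only [bind₁_C_right, derivation_C, map_zero, zero_mul, Finset.sum_const_zero, pderiv]
  | add p q hp hq => simp only [map_add, hp, hq, add_mul, Finset.sum_add_distrib]
  | mul_X p j hp =>
    have h1 : ∀ j', bind₁ F (pderiv j' (p * X j)) * dirDeriv v (F j') =
        F j * (bind₁ F (pderiv j' p) * dirDeriv v (F j')) +
          (if j = j' then bind₁ F p * dirDeriv v (F j') else 0) := by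
      intro j'
      rw [pderiv_mul, pderiv_X, map_add, map_mul, map_mul, bind₁_X_right, Pi.single_apply]
      split_ifs with h
      · simp only [map_one, mul_one]; ring
      · simp only [map_zero, mul_zero, add_zero]; ring
    rw [Finset.sum_congr rfl fun j' _ => h1 j', Finset.sum_add_distrib, Finset.sum_ite_eq,
      if_pos (Finset.mem_univ j), ← Finset.mul_sum, ← hp, map_mul, bind₁_X_right,
      Derivation.leibniz, smul_eq_mul, smul_eq_mul]
    ring

/-! ### The pull-back of polynomial forms -/

/-- Reindexing a sum over `(p+1)`-tuples by separating the `l`-th entry: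
`Σ_{J'} f(J') = Σⱼ Σ_J f(insertNth l j J)`. [folklore] -/
theorem sum_eq_sum_sum_insertNth {A : Type*} [AddCommMonoid A] (l : Fin (p + 1))
    (f : (Fin (p + 1) → Fin m) → A) :
    ∑ J', f J' = ∑ j : Fin m, ∑ J : Fin p → Fin m, f (Fin.insertNth l j J) := by
  rw [← (Fin.insertNthEquiv (fun _ => Fin m) l).sum_comp f, Fintype.sum_prod_type]
  rfl

/-- Removing the `l`-th vector from a tuple of coordinate fields `(e_{J' a})ₐ` gives the tuple of
coordinate fields of `J' ∘ l.succAbove` (definitional; recorded for rewriting). [folklore] -/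
theorem removeNth_single (l : Fin (p + 1)) (J' : Fin (p + 1) → Fin m) :
    l.removeNth (fun a => (Pi.single (J' a) 1 : Fin m → ℤ)) =
      fun b => Pi.single (J' (l.succAbove b)) 1 := rfl

/-- The pull-back as a multilinear map on constant integer vector fields:
`v ↦ Σ_J ω(e_J)(F) · ∏ₐ ∂_{vₐ} F_{J a}` (each summand is a product of the linear forms
`v ↦ ∂_v F_{J a}`, i.e. `dF_{J 1} ⊗ ⋯ ⊗ dF_{J p}` on constant fields). Auxiliary to
`PolyForm.comap`. [folklore] -/
def PolyForm.comapMultilinear (F : Fin m → MvPolynomial (Fin n) k) (ω : PolyForm k m p) :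
    MultilinearMap ℤ (fun _ : Fin p => Fin n → ℤ) (MvPolynomial (Fin n) k) :=
  ∑ J : Fin p → Fin m, bind₁ F (ω fun a => Pi.single (J a) 1) •
    (MultilinearMap.mkPiAlgebra ℤ (Fin p) (MvPolynomial (Fin n) k)).compLinearMap
      fun a => grad (F (J a))

/-- Unfolding `comapMultilinear`. [folklore] -/
theorem PolyForm.comapMultilinear_apply (F : Fin m → MvPolynomial (Fin n) k) (ω : PolyForm k m p)
    (v : Fin p → Fin n → ℤ) :
    PolyForm.comapMultilinear F ω v =
      ∑ J : Fin p → Fin m, bind₁ F (ω fun a => Pi.single (J a) 1) * ∏ a, dirDeriv (v a) (F (J a)) := by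
  simp [PolyForm.comapMultilinear]

/-- The multilinear pull-back is alternating: if `vₐ = v_b` with `a ≠ b`, the terms `J` and
`J ∘ swap(a, b)` cancel (`ω` is antisymmetric), and the fixed terms `J a = J b` vanish. [folklore] -/
theorem PolyForm.comapMultilinear_eq_zero_of_eq (F : Fin m → MvPolynomial (Fin n) k)
    (ω : PolyForm k m p) (v : Fin p → Fin n → ℤ) {a b : Fin p} (hv : v a = v b) (hab : a ≠ b) :
    PolyForm.comapMultilinear F ω v = 0 := by
  rw [PolyForm.comapMultilinear_apply]
  have hswap : ∀ J : Fin p → Fin m,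
      (∏ c, dirDeriv (v c) (F (J (Equiv.swap a b c)))) = ∏ c, dirDeriv (v c) (F (J c)) := by
    intro J
    have hv' : ∀ c, v (Equiv.swap a b c) = v c := fun c => by
      rcases eq_or_ne c a with rfl | hca
      · rw [Equiv.swap_apply_left, hv]
      rcases eq_or_ne c b with rfl | hcb
      · rw [Equiv.swap_apply_right, hv]
      · rw [Equiv.swap_apply_of_ne_of_ne hca hcb]
    calc (∏ c, dirDeriv (v c) (F (J (Equiv.swap a b c))))
        = ∏ c, dirDeriv (v (Equiv.swap a b c)) (F (J (Equiv.swap a b c))) := by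
          simp_rw [hv']
      _ = ∏ c, dirDeriv (v c) (F (J c)) :=
          Equiv.prod_comp (Equiv.swap a b) (fun c => dirDeriv (v c) (F (J c)))
  refine Finset.sum_involution (fun J _ => J ∘ Equiv.swap a b) (fun J _ => ?_) (fun J _ hJ => ?_)
    (fun J _ => Finset.mem_univ _) (fun J _ => ?_)
  · have h1 : (fun c => (Pi.single ((J ∘ Equiv.swap a b) c) 1 : Fin m → ℤ)) =
        (fun c => (Pi.single (J c) 1 : Fin m → ℤ)) ∘ Equiv.swap a b := rfl
    rw [h1, AlternatingMap.map_swap _ _ hab, map_neg, neg_mul]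
    simp only [Function.comp_apply, hswap, add_neg_cancel]
  · intro hJ'
    apply hJ
    have hJab : J a = J b := by
      have := congrFun hJ' a
      simpa using this.symm
    rw [AlternatingMap.map_eq_zero_of_eq _ _ (show (Pi.single (J a) 1 : Fin m → ℤ) =
      Pi.single (J b) 1 by rw [hJab]) hab, map_zero, zero_mul]
  · funext c
    simp [Function.comp_apply, Equiv.swap_apply_self]

/-- **Pull-back of polynomial forms** along the polynomial map `F = (F₁, …, F_m) : 𝔸ⁿ_k → 𝔸ᵐ_k`:
`F^* : Ω^p_{k[y]/k} → Ω^p_{k[x]/k}`,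
`(F^*ω)(v₁, …, v_p) = Σ_J ω(e_{J 1}, …, e_{J p})(F) · ∏ₐ ∂_{vₐ} F_{J a}`, so that
`F^*(g dy_{j₁} ∧ ⋯ ∧ dy_{j_p}) = g(F) dF_{j₁} ∧ ⋯ ∧ dF_{j_p}`; a `k`-linear map, semilinear over
`F♯ = bind₁ F : k[y] → k[x]` (`comap_polySmul`). This is the functoriality `Ω^p_{B/k} → Ω^p_{A/k}`
of Kähler forms along the algebra map `F♯` (Hartshorne II.8), in coordinates. [folklore] -/
def PolyForm.comap (F : Fin m → MvPolynomial (Fin n) k) : PolyForm k m p →ₗ[k] PolyForm k n p where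
  toFun ω :=
    { PolyForm.comapMultilinear F ω with
      map_eq_zero_of_eq' := fun v a b hv hab =>
        PolyForm.comapMultilinear_eq_zero_of_eq F ω v hv hab }
  map_add' ω₁ ω₂ := AlternatingMap.ext fun v => by
    change PolyForm.comapMultilinear F (ω₁ + ω₂) v =
      PolyForm.comapMultilinear F ω₁ v + PolyForm.comapMultilinear F ω₂ v
    simp [PolyForm.comapMultilinear_apply, add_mul, Finset.sum_add_distrib]
  map_smul' c ω := AlternatingMap.ext fun v => by
    change PolyForm.comapMultilinear F (c • ω) v = c • PolyForm.comapMultilinear F ω v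
    simp [PolyForm.comapMultilinear_apply, Finset.smul_sum]

/-- The defining formula of the pull-back. [folklore] -/
theorem PolyForm.comap_apply (F : Fin m → MvPolynomial (Fin n) k) (ω : PolyForm k m p)
    (v : Fin p → Fin n → ℤ) :
    PolyForm.comap F ω v =
      ∑ J : Fin p → Fin m, bind₁ F (ω fun a => Pi.single (J a) 1) * ∏ a, dirDeriv (v a) (F (J a)) :=
  PolyForm.comapMultilinear_apply F ω v

/-- On functions the pull-back is composition: `F^* g = g(F)`. [folklore] -/
@[simp]
theorem PolyForm.comap_ofPoly (F : Fin m → MvPolynomial (Fin n) k) (g : MvPolynomial (Fin m) k) :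
    PolyForm.comap F (ofPoly g) = ofPoly (bind₁ F g) := by
  refine AlternatingMap.ext fun v => ?_
  rw [PolyForm.comap_apply, ofPoly_apply]
  simp

/-- **Semilinearity** `F^*(g ω) = g(F) F^*ω` over `F♯ = bind₁ F`. [folklore] -/
theorem PolyForm.comap_polySmul (F : Fin m → MvPolynomial (Fin n) k) (g : MvPolynomial (Fin m) k)
    (ω : PolyForm k m p) : PolyForm.comap F (g • ω) = bind₁ F g • PolyForm.comap F ω := by
  refine AlternatingMap.ext fun v => ?_
  rw [AlternatingMap.smul_apply, PolyForm.comap_apply, PolyForm.comap_apply, smul_eq_mul,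
    Finset.mul_sum]
  refine Finset.sum_congr rfl fun J _ => ?_
  rw [AlternatingMap.smul_apply, smul_eq_mul, map_mul, mul_assoc]

/-- The pull-back packaged as a map **semilinear over `F♯ = bind₁ F`** (same function as
`PolyForm.comap F`; use it to take preimages of `k[x]`-submodules). [folklore] -/
def PolyForm.comapₛₗ (F : Fin m → MvPolynomial (Fin n) k) :
    PolyForm k m p →ₛₗ[(bind₁ F : MvPolynomial (Fin m) k →ₐ[k] MvPolynomial (Fin n) k).toRingHom]
      PolyForm k n p where
  toFun := PolyForm.comap F
  map_add' := map_add _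
  map_smul' := PolyForm.comap_polySmul F

/-- `comapₛₗ` is `comap` as a function. [folklore] -/
@[simp]
theorem PolyForm.comapₛₗ_apply (F : Fin m → MvPolynomial (Fin n) k) (ω : PolyForm k m p) :
    PolyForm.comapₛₗ F ω = PolyForm.comap F ω := rfl

/-! ### Compatibility with `dg ∧ ·` -/

/-- **`F^*(dg ∧ ω) = d(g ∘ F) ∧ F^*ω`** (the chain rule, and reindexing `J = (j, J')` at each
slot). [folklore] -/
theorem PolyForm.comap_dWedge (F : Fin m → MvPolynomial (Fin n) k) (g : MvPolynomial (Fin m) k)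
    (ω : PolyForm k m p) :
    PolyForm.comap F (dWedge g ω) = dWedge (bind₁ F g) (PolyForm.comap F ω) := by
  refine AlternatingMap.ext fun v => ?_
  rw [PolyForm.comap_apply]
  simp_rw [dWedge_apply, map_sum (bind₁ F), Finset.sum_mul]
  rw [Finset.sum_comm]
  refine Finset.sum_congr rfl fun l _ => ?_
  rw [sum_eq_sum_sum_insertNth l, dirDeriv_bind₁, PolyForm.comap_apply, Finset.sum_mul_sum,
    Finset.mul_sum]
  refine Finset.sum_congr rfl fun j _ => ?_
  rw [Finset.mul_sum]
  refine Finset.sum_congr rfl fun J _ => ?_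
  simp only [Fin.insertNth_apply_same, removeNth_single, Fin.removeNth,
    Fin.insertNth_apply_succAbove, Fin.prod_univ_succAbove _ l, dirDeriv_single_eq_pderiv, map_mul,
    map_pow, map_neg, map_one]
  ring

/-! ### The coordinate forms `dy_J` and the decomposition of a form -/

/-- The constant coordinate form `dy_J = dy_{J 0} ∧ (dy_{J 1} ∧ (⋯ ∧ dy_{J (p-1)}))` on `𝔸ᵐ`,
through the `dWedge` recursion (`dy_j ∧ θ = dWedge yⱼ θ`, starting from the `0`-form `1`).
For `J` strictly increasing these are the standard basis forms of `Ω^p_{k[y]/k}` over `k[y]`.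
[folklore] -/
def dXs : (p : ℕ) → (Fin p → Fin m) → PolyForm k m p
  | 0, _ => ofPoly 1
  | p + 1, J => dWedge (X (J 0)) (dXs p (Fin.tail J))

/-- `dy_J` for the empty tuple is the `0`-form `1`. [folklore] -/
@[simp] theorem dXs_zero (J : Fin 0 → Fin m) : (dXs 0 J : PolyForm k m 0) = ofPoly 1 := rfl

/-- `dy_J = dy_{J 0} ∧ dy_{tail J}`. [folklore] -/
theorem dXs_succ (J : Fin (p + 1) → Fin m) :
    (dXs (p + 1) J : PolyForm k m (p + 1)) = dWedge (X (J 0)) (dXs p (Fin.tail J)) := rfl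

/-- The `0`-form `1` is closed: `d1 = 0`. [folklore] -/
@[simp] theorem extDeriv_ofPoly_one : extDeriv (ofPoly (1 : MvPolynomial (Fin m) k)) = 0 :=
  AlternatingMap.ext fun v => by simp

/-- The coordinate forms are closed: `d(dy_J) = 0`. [folklore] -/
theorem extDeriv_dXs : ∀ (p : ℕ) (J : Fin p → Fin m), extDeriv (dXs p J : PolyForm k m p) = 0
  | 0, _ => extDeriv_ofPoly_one
  | p + 1, J => by rw [dXs_succ, extDeriv_dWedge, extDeriv_dXs p, dWedge_zero, neg_zero]

/-- **`d(F^* dy_J) = d(dF_{J 0} ∧ ⋯ ∧ dF_{J (p-1)}) = 0`**: pull-backs of the coordinate forms are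
closed (Leibniz rule and `d ∘ d = 0`, through `d(df ∧ η) = -df ∧ dη`). [folklore] -/
theorem extDeriv_comap_dXs (F : Fin m → MvPolynomial (Fin n) k) :
    ∀ (p : ℕ) (J : Fin p → Fin m), extDeriv (PolyForm.comap F (dXs p J : PolyForm k m p)) = 0
  | 0, _ => by rw [dXs_zero, PolyForm.comap_ofPoly, map_one, extDeriv_ofPoly_one]
  | p + 1, J => by
    rw [dXs_succ, PolyForm.comap_dWedge, extDeriv_dWedge, extDeriv_comap_dXs F p, dWedge_zero,
      neg_zero]

/-- The tail of a strictly increasing tuple is strictly increasing. [folklore] -/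
theorem _root_.StrictMono.fin_tail {α : Type*} [Preorder α] {J : Fin (p + 1) → α}
    (hJ : StrictMono J) : StrictMono (Fin.tail J) :=
  hJ.comp Fin.strictMono_succ

/-- **The coordinate forms on increasing basis tuples are Kronecker deltas**: for strictly
increasing `J, J' : Fin p → Fin m`, `dy_J(e_{J' 0}, …, e_{J' (p-1)}) = [J = J']`. [folklore] -/
theorem dXs_apply_single : ∀ (p : ℕ) {J J' : Fin p → Fin m}, StrictMono J → StrictMono J' →
    (dXs p J : PolyForm k m p) (fun a => Pi.single (J' a) 1) = if J = J' then 1 else 0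
  | 0, J, J', _, _ => by
    rw [if_pos (funext fun a => Fin.elim0 a), dXs_zero, ofPoly_apply]
  | p + 1, J, J', hJ, hJ' => by
    have key : ∀ l : Fin (p + 1), dirDeriv (Pi.single (J' l) 1 : Fin m → ℤ)
        (X (J 0) : MvPolynomial (Fin m) k) = if J 0 = J' l then 1 else 0 := by
      intro l
      rw [dirDeriv_X, Pi.single_apply]
      split_ifs <;> simp
    have IH : ∀ l : Fin (p + 1), (dXs p (Fin.tail J) : PolyForm k m p)
        (l.removeNth fun a => (Pi.single (J' a) 1 : Fin m → ℤ)) =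
          if Fin.tail J = J' ∘ l.succAbove then 1 else 0 := fun l =>
      dXs_apply_single p hJ.fin_tail (hJ'.comp (Fin.strictMono_succAbove l))
    rw [dXs_succ, dWedge_apply]
    simp_rw [key, IH]
    by_cases h : J = J'
    · subst h
      rw [if_pos rfl, Finset.sum_eq_single (0 : Fin (p + 1)) (fun l _ hl => ?_) (by simp)]
      · rw [if_pos rfl, if_pos (by rw [Fin.succAbove_zero]; rfl)]
        simp
      · rw [if_neg (fun h0 => hl (hJ.injective h0).symm)]
        simp
    · rw [if_neg h]
      refine Finset.sum_eq_zero fun l _ => ?_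
      by_cases h1 : J 0 = J' l
      · by_cases h2 : Fin.tail J = J' ∘ l.succAbove
        · exfalso
          apply h
          rcases eq_or_ne l 0 with rfl | hl
          · funext a
            refine Fin.cases h1 (fun b => ?_) a
            have := congrFun h2 b
            simpa [Fin.tail, Fin.succAbove_zero] using this
          · have hl' : 0 < (l : ℕ) := Nat.pos_of_ne_zero fun h0 => hl (Fin.ext h0)
            have hp : 0 < p := by have := l.isLt; omega
            have e0 : l.succAbove ⟨0, hp⟩ = ⟨0, by omega⟩ := by
              rw [Fin.succAbove_of_castSucc_lt _ _ (by rw [Fin.lt_def]; exact hl')]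
              rfl
            have e1 : J (Fin.succ ⟨0, hp⟩) = J' ⟨0, by omega⟩ := by
              have := congrFun h2 ⟨0, hp⟩
              rwa [Fin.tail, Function.comp_apply, e0] at this
            have lt1 : J' ⟨0, by omega⟩ < J' l := hJ' (by rw [Fin.lt_def]; exact hl')
            have lt2 : J 0 < J (Fin.succ ⟨0, hp⟩) := hJ (by rw [Fin.lt_def]; simp)
            rw [← e1, ← h1] at lt1
            exact absurd (lt1.trans lt2) (lt_irrefl _)
        · rw [if_neg h2]
          simp
      · rw [if_neg h1]
        simp

/-- Evaluation of a finite sum of alternating maps. [folklore] -/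
theorem _root_.AlternatingMap.finset_sum_apply {R M N ι κ : Type*} [Semiring R] [AddCommMonoid M]
    [Module R M] [AddCommMonoid N] [Module R N] (s : Finset κ) (f : κ → M [⋀^ι]→ₗ[R] N)
    (v : ι → M) : (∑ c ∈ s, f c) v = ∑ c ∈ s, f c v := by
  induction s using Finset.cons_induction with
  | empty => simp
  | cons a s ha ih => rw [Finset.sum_cons, Finset.sum_cons, AlternatingMap.add_apply, ih]

open Set.powersetCard in
/-- Two alternating maps out of a module with a basis `b` indexed by a linear order agree as soon
as they agree on the increasing basis tuples `(b_{s₁}, …, b_{s_p})`, `s₁ < ⋯ < s_p` (through the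
basis `Module.Basis.exteriorPower` of `⋀ᵖ` and `exteriorPower.alternatingMapLinearEquiv`).
[folklore] -/
theorem _root_.AlternatingMap.ext_of_basis_powersetCard {R M N I : Type*} [CommRing R]
    [AddCommGroup M] [Module R M] [AddCommGroup N] [Module R N] [LinearOrder I]
    (b : Module.Basis I R M) {q : ℕ} {f g : M [⋀^Fin q]→ₗ[R] N}
    (h : ∀ s : Set.powersetCard I q,
      f (fun a => b (ofFinEmbEquiv.symm s a)) = g (fun a => b (ofFinEmbEquiv.symm s a))) :
    f = g := by
  apply exteriorPower.alternatingMapLinearEquiv.injective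
  refine (b.exteriorPower q).ext fun s => ?_
  rw [exteriorPower.basis_apply]
  change exteriorPower.alternatingMapLinearEquiv f (exteriorPower.ιMulti R q _) =
    exteriorPower.alternatingMapLinearEquiv g (exteriorPower.ιMulti R q _)
  rw [exteriorPower.alternatingMapLinearEquiv_apply_ιMulti,
    exteriorPower.alternatingMapLinearEquiv_apply_ιMulti]
  exact h s

open Set.powersetCard in
/-- **Decomposition of a polynomial form in the coordinate forms**:
`ω = Σ_{s = {s₁ < ⋯ < s_p}} ω(e_{s₁}, …, e_{s_p}) · dy_s` (sum over the `p`-element subsets of the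
coordinates; both sides are alternating and agree on increasing basis tuples by
`dXs_apply_single`). [folklore] -/
theorem PolyForm.eq_sum_smul_dXs (ω : PolyForm k m p) :
    ω = ∑ s : Set.powersetCard (Fin m) p,
      ω (fun a => Pi.single (ofFinEmbEquiv.symm s a) 1) • dXs p (ofFinEmbEquiv.symm s) := by
  refine AlternatingMap.ext_of_basis_powersetCard (Pi.basisFun ℤ (Fin m)) fun t => ?_
  simp only [Pi.basisFun_apply]
  rw [AlternatingMap.finset_sum_apply, Finset.sum_eq_single t (fun s _ hst => ?_) (by simp)]
  · rw [AlternatingMap.smul_apply, smul_eq_mul,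
      dXs_apply_single p (ofFinEmbEquiv.symm t).strictMono (ofFinEmbEquiv.symm t).strictMono,
      if_pos rfl, mul_one]
  · rw [AlternatingMap.smul_apply, smul_eq_mul,
      dXs_apply_single p (ofFinEmbEquiv.symm s).strictMono (ofFinEmbEquiv.symm t).strictMono,
      if_neg (fun hst' => hst ?_), mul_zero]
    exact ofFinEmbEquiv.symm.injective (DFunLike.coe_injective hst')

/-! ### `F^*` commutes with `d` -/

/-- **Naturality of the exterior derivative**: `F^*(dω) = d(F^*ω)` for every polynomial form `ω`
and polynomial map `F` (decompose `ω = Σ g_s dy_s`; then `d(g dy_s) = dg ∧ dy_s`,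
`F^*(dg ∧ dy_s) = d(g ∘ F) ∧ F^* dy_s` and `d(F^* dy_s) = 0`). This is the functoriality of the
de Rham complex `Ω^•_{·/k}` [Hartshorne 1977, II.8; Grothendieck 1966, p. 96]. [folklore] -/
theorem PolyForm.comap_extDeriv (F : Fin m → MvPolynomial (Fin n) k) (ω : PolyForm k m p) :
    PolyForm.comap F (extDeriv ω) = extDeriv (PolyForm.comap F ω) := by
  conv_lhs => rw [PolyForm.eq_sum_smul_dXs ω]
  conv_rhs => rw [PolyForm.eq_sum_smul_dXs ω]
  rw [← extDerivₗ_apply, map_sum, map_sum, map_sum, ← extDerivₗ_apply, map_sum]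
  refine Finset.sum_congr rfl fun s _ => ?_
  rw [extDerivₗ_apply, extDerivₗ_apply, extDeriv_smul, extDeriv_dXs, smul_zero, add_zero,
    PolyForm.comap_dWedge, PolyForm.comap_polySmul, extDeriv_smul, extDeriv_comap_dXs, smul_zero,
    add_zero]

/-! ### Forms vanishing on a subscheme, closed and exact forms -/

variable {I : Ideal (MvPolynomial (Fin n) k)} {I' : Ideal (MvPolynomial (Fin m) k)}

/-- If `F` maps `V(I)` into `V(I')` algebraically — `F♯(I') ⊆ I`, i.e. `I'.map (bind₁ F) ≤ I` —
then `F^*` maps the forms vanishing on `V(I')` to forms vanishing on `V(I)` (the differential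
graded ideal generated by `I'` goes to the one generated by `I`, since `F^*` is multiplicative on
functions and commutes with `d`). Hence `F^*` descends to regular forms
`Ω^p(V(I')) → Ω^p(V(I))`. [folklore] -/
theorem PolyForm.comap_mem_vanishingForms (F : Fin m → MvPolynomial (Fin n) k)
    (hF : I'.map (bind₁ F : MvPolynomial (Fin m) k →ₐ[k] MvPolynomial (Fin n) k) ≤ I) :
    ∀ {p : ℕ} {ω : PolyForm k m p}, ω ∈ vanishingForms I' p →
      PolyForm.comap F ω ∈ vanishingForms I p := by
  intro p ω hω
  have h := vanishingForms_le I' (N := fun q => (vanishingForms I q).comap (PolyForm.comapₛₗ F))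
    (fun q => Submodule.smul_le.mpr fun g hg θ _ => ?_) (fun q θ hθ => ?_) p hω
  · exact h
  · rw [Submodule.mem_comap, PolyForm.comapₛₗ_apply, PolyForm.comap_polySmul]
    exact smul_mem_vanishingForms I (hF (Ideal.mem_map_of_mem _ hg)) _
  · rw [Submodule.mem_comap, PolyForm.comapₛₗ_apply] at hθ
    rw [Submodule.mem_comap, PolyForm.comapₛₗ_apply, PolyForm.comap_extDeriv]
    exact extDeriv_mem_vanishingForms I hθ

/-- Pull-back preserves closedness: if `F` maps `V(I)` into `V(I')` (`I'.map F♯ ≤ I`) and `ω` is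
closed on `V(I')`, then `F^*ω` is closed on `V(I)`. [folklore] -/
theorem IsClosedOn.comap (F : Fin m → MvPolynomial (Fin n) k)
    (hF : I'.map (bind₁ F : MvPolynomial (Fin m) k →ₐ[k] MvPolynomial (Fin n) k) ≤ I)
    {ω : PolyForm k m p} (hω : IsClosedOn I' ω) : IsClosedOn I (PolyForm.comap F ω) := by
  unfold IsClosedOn at hω ⊢
  rw [← PolyForm.comap_extDeriv]
  exact PolyForm.comap_mem_vanishingForms F hF hω

/-- Pull-back preserves exactness: if `F` maps `V(I)` into `V(I')` (`I'.map F♯ ≤ I`) and `ω` is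
exact on `V(I')` (primitive `η`), then `F^*ω` is exact on `V(I)` (primitive `F^*η`). [folklore] -/
theorem IsExactOn.comap (F : Fin m → MvPolynomial (Fin n) k)
    (hF : I'.map (bind₁ F : MvPolynomial (Fin m) k →ₐ[k] MvPolynomial (Fin n) k) ≤ I) :
    ∀ {p : ℕ} {ω : PolyForm k m p}, IsExactOn I' ω → IsExactOn I (PolyForm.comap F ω)
  | 0, _, hω => PolyForm.comap_mem_vanishingForms F hF hω
  | p + 1, _, ⟨η, hη⟩ => ⟨PolyForm.comap F η, by
      rw [← PolyForm.comap_extDeriv, ← map_sub]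
      exact PolyForm.comap_mem_vanishingForms F hF hη⟩

/-- The induced map on regular forms, `F^* : Ω^p(V(I')) → Ω^p(V(I))` (`k`-linear), for `F`
mapping `V(I)` into `V(I')` (`I'.map F♯ ≤ I`): functoriality of Kähler `p`-forms
`Ω^p_{B/k} → Ω^p_{A/k}` along `B = k[y]/I' → A = k[x]/I` (Hartshorne II.8). [folklore] -/
def RegularForm.comap (F : Fin m → MvPolynomial (Fin n) k)
    (hF : I'.map (bind₁ F : MvPolynomial (Fin m) k →ₐ[k] MvPolynomial (Fin n) k) ≤ I) (p : ℕ) :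
    RegularForm I' p →ₗ[k] RegularForm I p :=
  ((vanishingForms I' p).restrictScalars k).liftQ
      (((vanishingForms I p).mkQ.restrictScalars k) ∘ₗ PolyForm.comap F)
      (fun _ hω => (Submodule.Quotient.mk_eq_zero _).mpr
        (PolyForm.comap_mem_vanishingForms F hF hω)) ∘ₗ
    (Submodule.Quotient.restrictScalarsEquiv k (vanishingForms I' p)).symm.toLinearMap

/-- `F^*` of the restriction of `ω` to `V(I')` is the restriction of `F^*ω` to `V(I)`. [folklore] -/
@[simp]
theorem RegularForm.comap_mk (F : Fin m → MvPolynomial (Fin n) k)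
    (hF : I'.map (bind₁ F : MvPolynomial (Fin m) k →ₐ[k] MvPolynomial (Fin n) k) ≤ I)
    (ω : PolyForm k m p) :
    RegularForm.comap F hF p (RegularForm.mk I' ω) = RegularForm.mk I (PolyForm.comap F ω) :=
  rfl

/-- The induced map on regular forms commutes with `d` (so it induces
`F^* : H^p_dR(V(I')) → H^p_dR(V(I))`). [folklore] -/
theorem RegularForm.d_comap (F : Fin m → MvPolynomial (Fin n) k)
    (hF : I'.map (bind₁ F : MvPolynomial (Fin m) k →ₐ[k] MvPolynomial (Fin n) k) ≤ I)
    (x : RegularForm I' p) :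
    RegularForm.d I (RegularForm.comap F hF p x) =
      RegularForm.comap F hF (p + 1) (RegularForm.d I' x) := by
  obtain ⟨ω, rfl⟩ := RegularForm.mk_surjective I' x
  rw [RegularForm.comap_mk, RegularForm.d_mk, RegularForm.d_mk, RegularForm.comap_mk,
    PolyForm.comap_extDeriv]

end AffineDeRham

end Literature.AlgebraicGeometry.Motives

end
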